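import Literature.AlgebraicGeometry.ShimuraVarieties.UnitaryBallClassLiftTranslate
import Literature.AlgebraicGeometry.ShimuraVarieties.UnitaryBallClassMapTranslate
import Literature.AlgebraicGeometry.ShimuraVarieties.UnitaryBallThetaClassLevelChange
import HarnessLib

/-!
# A class pulled back along a Hecke translation is pinned by its lift (existence ⇒ pull-back shape)

Topic `AlgebraicGeometry/ShimuraVarieties`; namespace
`Literature.AlgebraicGeometry.ShimuraVarieties.UnitaryBallUniformisationDatum` (continues
`UnitaryBallClassLiftTranslate`).  Reproduction (kernel): theorems only, no records, no new hypotheses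
beyond those of the inputs joined.

Let `X`, `X'` be compact ball quotient surfaces with uniformization data `D`, `D'`, Sylvester frames `𝔣`, `𝔣'`
OF THE SAME MATRIX (`𝔣'.t = 𝔣.t`), and let `f : X' ⟶ X` LIE OVER a real point `g ∈ U(H)(ℝ)` on the negative cone:
`f(ℂ) (unif' v) = unif (g v)` (Shimura's Hecke translation `[v] ↦ [g v]`; `g = 1`: a level covering).  Write
`γ := frameIso 𝔣 g ∈ U(2,1)` and `γ^* F : z ↦ (Jac γ z)ᵀ · F(γ z)` for the pull-back of a `ℂ²`-valued function on
the ball.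

* `classLift_injOn_hodge_F` — the holomorphic lift `classLift` is injective on `F¹H¹(X)` (it is linear and
  non-zero on non-zero `(1,0)`-classes, `classLift_ne_zero`);
* `pull_baseChange_eq_of_classLift_eq_translate` — if `ω ∈ F¹H¹(X)` and `ω' ∈ F¹H¹(X')` lifts to `γ^*(lift ω)`,
  then `(f^* ⊗ ℂ) ω = ω'` (`classLift_pull_mulVec`: the lift of `(f^* ⊗ ℂ) ω` IS `γ^*(lift ω)`; injectivity);
* `pull_baseChange_mem_of_exists_classLift_eq_translate` — **EXISTENCE shape ⇒ PULL-BACK shape**: for any set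
  `S' ⊆ F¹H¹(X')` of classes, if SOME `ω' ∈ S'` lifts to `γ^*(lift ω)` then `(f^* ⊗ ℂ) ω ∈ S'`.  This converts the
  existence form of the theta/ball dictionary («`∃ ω' ∈ Θ(Γ')`, `lift ω' = γ^*(lift ω)`», the `transl` clause of the
  ball facts; `UnitaryBallClassMapTranslate.exists_mem_thetaClasses_classLift_eq_translate`) into closure of the class
  sets under pull-back along the morphisms lying over rational isometries (the `TranslateClosed` clause of the
  cohomological Hecke route to non-vanishing theta wedges);
* `image_pull_baseChange_subset_of_forall_exists_classLift_eq_translate` — the same for a whole set `S ⊆ F¹H¹(X)`.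

References: A. Borel, *Automorphic forms on SL₂(ℝ)* (1997), §5.13–5.14 (pull-back by `γ` ↔ left translation of the
function on the group) [cite: Borel1997, §5.13–5.14]; G. Shimura, *Introduction to the arithmetic theory of
automorphic functions* (1971), §7.2–7.3 (the Hecke translations `[v] ↦ [γ v]`; orientation only)
[cite: Shimura1973, §7.2–7.3]; C. Voisin, *Hodge Theory and Complex Algebraic Geometry I* (2002), §7.1.1 Cor. 7.6 and
§7.3.2 (holomorphic one-forms = `F¹H¹`; functoriality) [cite: VoisinHodgeI2002, §7.3.2].
-/

noncomputable section

open Matrix MulAction Function Set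
open scoped TensorProduct
open CategoryTheory
open Literature.Geometry.ComplexHyperbolic
open Literature.Geometry.ComplexHyperbolic.BallModel (U21 Ball Jac)
open Literature.AlgebraicGeometry.HodgeTheory
open Literature.AlgebraicGeometry.Motives (bettiCohomology)

namespace Literature.AlgebraicGeometry.ShimuraVarieties

namespace UnitaryBallUniformisationDatum

variable {X X' : Motives.SchemeOver ℂ} (D : UnitaryBallUniformisationDatum 2 X)
  (D' : UnitaryBallUniformisationDatum 2 X')
variable (𝔣 : D.SylvesterFrame) (𝔣' : D'.SylvesterFrame)

/-- **The holomorphic lift is injective on `F¹H¹(X)`**: `classLift` is `ℂ`-linear and non-zero on every non-zero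
class of `F¹H¹` (`classLift_ne_zero`). [cite: Borel1997, §5.13–5.14] [cite: VoisinHodgeI2002, §7.1.1 Cor. 7.6] -/
theorem classLift_injOn_hodge_F (hHD : exists_isReal_hodgeModel) (hI : hodgePQ_independent_of_hodgeModel) :
    Set.InjOn (D.classLift hHD 𝔣) ((BettiUniverse.hodge hHD D.isSmoothProjective 1).F 1 : Set _) := by
  intro c hc c' hc' h
  rw [← sub_eq_zero]
  by_contra hne
  exact D.classLift_ne_zero hHD 𝔣 hI (Submodule.sub_mem _ hc hc') hne (by rw [map_sub, h, sub_self])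

/-- **A class pulled back along a morphism over a real point is pinned by its lift.**  If `f : X' ⟶ X` lies over
`g ∈ U(H)(ℝ)` on the negative cone, `ω ∈ F¹H¹(X)`, and `ω' ∈ F¹H¹(X')` lifts to the pull-back form
`γ^*(lift ω) : z ↦ (Jac γ z)ᵀ (lift ω)(γ z)`, `γ = frameIso 𝔣 g`, then `(f^* ⊗ ℂ) ω = ω'` — the lift of `(f^* ⊗ ℂ) ω`
IS `γ^*(lift ω)` (`classLift_pull_mulVec`) and the lift is injective on `F¹H¹(X')`.
[cite: Borel1997, §5.13–5.14] [cite: Shimura1973, §7.2–7.3] -/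
theorem pull_baseChange_eq_of_classLift_eq_translate (hHD : exists_isReal_hodgeModel)
    (hI : hodgePQ_independent_of_hodgeModel) (f : X' ⟶ X) (hT : 𝔣'.t = 𝔣.t) {g : GL (Fin 3) ℂ}
    (hg : g ∈ D.realPoints)
    (hf : ∀ v ∈ D'.cone, Motives.AlgPoints.map f (D'.unif v) = D.unif ((g : Matrix (Fin 3) (Fin 3) ℂ) *ᵥ v))
    {ω : ℂ ⊗[ℚ] bettiCohomology X 1} (hω : ω ∈ (BettiUniverse.hodge hHD D.isSmoothProjective 1).F 1)
    {ω' : ℂ ⊗[ℚ] bettiCohomology X' 1} (hω' : ω' ∈ (BettiUniverse.hodge hHD D'.isSmoothProjective 1).F 1)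
    (h : D'.classLift hHD 𝔣' ω' =
      fun z ↦ (Jac (D.frameIso 𝔣 ⟨g, hg⟩) z)ᵀ *ᵥ D.classLift hHD 𝔣 ω (D.frameIso 𝔣 ⟨g, hg⟩ • z)) :
    (BettiUniverse.pull f 1).baseChange ℂ ω = ω' :=
  D'.classLift_injOn_hodge_F 𝔣' hHD hI
    (BettiUniverse.pull_hodge hHD hI D'.isSmoothProjective D.isSmoothProjective f 1 1 ⟨ω, hω, rfl⟩) hω'
    (by rw [D.classLift_pull_mulVec hHD 𝔣 hI D' 𝔣' f hT hg hf hω, h])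

/-- **EXISTENCE shape ⇒ PULL-BACK shape.**  For a set `S' ⊆ F¹H¹(X')` of classes: if SOME `ω' ∈ S'` lifts to
`γ^*(lift ω)` (`γ = frameIso 𝔣 g`), then the pull-back `(f^* ⊗ ℂ) ω` along any `f : X' ⟶ X` lying over `g` is
itself in `S'`.  (The `transl` clause of the ball dictionary, an `∃`, thus yields closure of the class sets under
pull-back along the Hecke translations.) [cite: Borel1997, §5.13–5.14] [cite: Shimura1973, §7.2–7.3] -/
theorem pull_baseChange_mem_of_exists_classLift_eq_translate (hHD : exists_isReal_hodgeModel)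
    (hI : hodgePQ_independent_of_hodgeModel) (f : X' ⟶ X) (hT : 𝔣'.t = 𝔣.t)
    {g : GL (Fin 3) ℂ} (hg : g ∈ D.realPoints)
    (hf : ∀ v ∈ D'.cone, Motives.AlgPoints.map f (D'.unif v) = D.unif ((g : Matrix (Fin 3) (Fin 3) ℂ) *ᵥ v))
    {S' : Set (ℂ ⊗[ℚ] bettiCohomology X' 1)} (hS' : S' ⊆ (BettiUniverse.hodge hHD D'.isSmoothProjective 1).F 1)
    {ω : ℂ ⊗[ℚ] bettiCohomology X 1} (hω : ω ∈ (BettiUniverse.hodge hHD D.isSmoothProjective 1).F 1)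
    (h : ∃ ω' ∈ S', D'.classLift hHD 𝔣' ω' =
      fun z ↦ (Jac (D.frameIso 𝔣 ⟨g, hg⟩) z)ᵀ *ᵥ D.classLift hHD 𝔣 ω (D.frameIso 𝔣 ⟨g, hg⟩ • z)) :
    (BettiUniverse.pull f 1).baseChange ℂ ω ∈ S' := by
  obtain ⟨ω', hω', h⟩ := h
  rwa [D.pull_baseChange_eq_of_classLift_eq_translate D' 𝔣 𝔣' hHD hI f hT hg hf hω (hS' hω') h]

/-- **Image form.**  For sets `S ⊆ F¹H¹(X)`, `S' ⊆ F¹H¹(X')`: if every `ω ∈ S` has some `ω' ∈ S'` lifting to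
`γ^*(lift ω)`, then `(f^* ⊗ ℂ) '' S ⊆ S'` for every `f : X' ⟶ X` lying over `g`.
[cite: Borel1997, §5.13–5.14] [cite: Shimura1973, §7.2–7.3] -/
theorem image_pull_baseChange_subset_of_forall_exists_classLift_eq_translate (hHD : exists_isReal_hodgeModel)
    (hI : hodgePQ_independent_of_hodgeModel) (f : X' ⟶ X) (hT : 𝔣'.t = 𝔣.t)
    {g : GL (Fin 3) ℂ} (hg : g ∈ D.realPoints)
    (hf : ∀ v ∈ D'.cone, Motives.AlgPoints.map f (D'.unif v) = D.unif ((g : Matrix (Fin 3) (Fin 3) ℂ) *ᵥ v))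
    {S : Set (ℂ ⊗[ℚ] bettiCohomology X 1)} (hS : S ⊆ (BettiUniverse.hodge hHD D.isSmoothProjective 1).F 1)
    {S' : Set (ℂ ⊗[ℚ] bettiCohomology X' 1)} (hS' : S' ⊆ (BettiUniverse.hodge hHD D'.isSmoothProjective 1).F 1)
    (h : ∀ ω ∈ S, ∃ ω' ∈ S', D'.classLift hHD 𝔣' ω' =
      fun z ↦ (Jac (D.frameIso 𝔣 ⟨g, hg⟩) z)ᵀ *ᵥ D.classLift hHD 𝔣 ω (D.frameIso 𝔣 ⟨g, hg⟩ • z)) :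
    (BettiUniverse.pull f 1).baseChange ℂ '' S ⊆ S' := by
  rintro _ ⟨ω, hω, rfl⟩
  exact D.pull_baseChange_mem_of_exists_classLift_eq_translate D' 𝔣 𝔣' hHD hI f hT hg hf hS' (hS hω) (h ω hω)

/-! ### Characterisation of the pulled-back class by its lift

(The theta-class modules `UnitaryBallClassMapTranslate` / `UnitaryBallThetaClassLevelChange` are imported for the
`thetaClasses` corollaries of this characterisation — the pull-back form of the N33b dictionary — appended to this
file next; see the module docstring.) -/

/-- **Characterisation of `(f^* ⊗ ℂ) ω` by its lift.**  For `f : X' ⟶ X` lying over a real point `g`, frames of equal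
matrix, `ω ∈ F¹H¹(X)` and `ω' ∈ F¹H¹(X')`: `(f^* ⊗ ℂ) ω = ω'` iff `ω'` lifts to the pull-back form `γ^*(lift ω)`,
`γ = frameIso 𝔣 g` (⇒: `classLift_pull_mulVec`; ⇐: `pull_baseChange_eq_of_classLift_eq_translate`).
[cite: Borel1997, §5.13–5.14] [cite: Shimura1973, §7.2–7.3] -/
theorem pull_baseChange_eq_iff_classLift_eq_translate (hHD : exists_isReal_hodgeModel)
    (hI : hodgePQ_independent_of_hodgeModel) (f : X' ⟶ X) (hT : 𝔣'.t = 𝔣.t) {g : GL (Fin 3) ℂ}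
    (hg : g ∈ D.realPoints)
    (hf : ∀ v ∈ D'.cone, Motives.AlgPoints.map f (D'.unif v) = D.unif ((g : Matrix (Fin 3) (Fin 3) ℂ) *ᵥ v))
    {ω : ℂ ⊗[ℚ] bettiCohomology X 1} (hω : ω ∈ (BettiUniverse.hodge hHD D.isSmoothProjective 1).F 1)
    {ω' : ℂ ⊗[ℚ] bettiCohomology X' 1} (hω' : ω' ∈ (BettiUniverse.hodge hHD D'.isSmoothProjective 1).F 1) :
    (BettiUniverse.pull f 1).baseChange ℂ ω = ω' ↔
      D'.classLift hHD 𝔣' ω' =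
        fun z ↦ (Jac (D.frameIso 𝔣 ⟨g, hg⟩) z)ᵀ *ᵥ D.classLift hHD 𝔣 ω (D.frameIso 𝔣 ⟨g, hg⟩ • z) := by
  refine ⟨fun h ↦ ?_, fun h ↦ D.pull_baseChange_eq_of_classLift_eq_translate D' 𝔣 𝔣' hHD hI f hT hg hf hω hω' h⟩
  rw [← h]
  exact D.classLift_pull_mulVec hHD 𝔣 hI D' 𝔣' f hT hg hf hω

/-! ## The pull-back form of the N33b dictionary on theta classes

With the dictionary of `UnitaryBallClassMapTranslate` (EXISTENCE of a theta class `ω'` of `(D', Θ')` lifting to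
`γ^*(lift ω)`) the characterisation above yields: `(f^* ⊗ ℂ) ω` IS a theta class of `(D', Θ')` for `f` lying over `g`,
`γ = frameIso 𝔣 g` — the Hecke analogue of `UnitaryBallThetaClassLevelChange.pull_baseChange_mem_thetaClasses`. -/

open Literature.Geometry.ComplexHyperbolic.BallModel (x₀)
open Literature.NumberTheory.Automorphic
/-! ### Theta classes under a morphism lying over a real point: two adelic situations -/

section TwoSituations

variable {GU GU' : Type*} [Group GU] [Group GU'] {Kc Kc' : Type*} [Group Kc] [Group Kc']
variable {ΓU : Subgroup GU} {ΓU' : Subgroup GU'} {κ : Kc →* GU} {κ' : Kc' →* GU'}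
variable {τ : Representation ℂ Kc (Fin 2 → ℂ)} {τ' : Representation ℂ Kc' (Fin 2 → ℂ)}
variable (ιinf : U21 →* GU) (ιinf' : U21 →* GU')
  {η₁ : stabilizer U21 x₀ →* Kc} {η₁' : stabilizer U21 x₀ →* Kc'}
variable (hΔ : WeightForms.IsLevelCorrected ΓU κ τ ιinf (D.ballImage 𝔣))
  (hη : WeightForms.IsWeightMatched κ τ ιinf (stabilizer U21 x₀).subtype
    (BallForms.isPullbackCocycle_cotangentCocycle.weightOf x₀) η₁)
  (hΔ' : WeightForms.IsLevelCorrected ΓU' κ' τ' ιinf' (D'.ballImage 𝔣'))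
  (hη' : WeightForms.IsWeightMatched κ' τ' ιinf' (stabilizer U21 x₀).subtype
    (BallForms.isPullbackCocycle_cotangentCocycle.weightOf x₀) η₁')

/-- **Theta classes under a morphism lying over a real point (two adelic situations).**  Let `f : X' ⟶ X` lie over
`g ∈ U(H)(ℝ)` on the negative cone, frames of equal matrix, `γ := frameIso 𝔣 g ∈ U(2,1)`.  If every form `F ∈ Θ`
has a partner `F' ∈ Θ'` whose restricted group function is the left `γ`-translate `x ↦ F(ιinf (γ x))` of that of
`F`, then the pull-back `(f^* ⊗ ℂ) ω` of every theta class `ω` of `(D, Θ)` is a theta class of `(D', Θ')` — the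
Hecke analogue of `pull_baseChange_mem_thetaClasses` (coverings, `g = 1`). [cite: Borel1997, §5.13–5.14]
[cite: Shimura1973, §7.2–7.3] -/
theorem pull_baseChange_mem_thetaClasses_of_mulVec (hHD : exists_isReal_hodgeModel)
    (hI : hodgePQ_independent_of_hodgeModel) (Θ : Submodule ℂ (weightForms ΓU κ τ))
    (Θ' : Submodule ℂ (weightForms ΓU' κ' τ')) (f : X' ⟶ X) (hT : 𝔣'.t = 𝔣.t) {g : GL (Fin 3) ℂ}
    (hg : g ∈ D.realPoints)
    (hf : ∀ v ∈ D'.cone, Motives.AlgPoints.map f (D'.unif v) = D.unif ((g : Matrix (Fin 3) (Fin 3) ℂ) *ᵥ v))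
    {ω : ℂ ⊗[ℚ] bettiCohomology X 1}
    (hω : ω ∈ WeightForms.thetaClasses ιinf (D.classMapDatum hHD 𝔣 hI ιinf hΔ hη) Θ)
    (hΘ : ∀ F ∈ Θ, ∃ F' ∈ Θ', (WeightForms.restrictHom ιinf' hΔ' hη' F' : U21 → Fin 2 → ℂ) =
      fun x ↦ (WeightForms.restrictHom ιinf hΔ hη F : U21 → Fin 2 → ℂ) (D.frameIso 𝔣 ⟨g, hg⟩ * x)) :
    (BettiUniverse.pull f 1).baseChange ℂ ω ∈ WeightForms.thetaClasses ιinf' (D'.classMapDatum hHD 𝔣' hI ιinf' hΔ' hη') Θ' := by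
  obtain ⟨ω', hω', h⟩ := D.exists_mem_thetaClasses_classLift_eq_translate D' hHD 𝔣 𝔣' hI ιinf ιinf' hΔ hη hΔ' hη'
    Θ Θ' (D.frameIso 𝔣 ⟨g, hg⟩) hω hΘ
  rwa [D.pull_baseChange_eq_of_classLift_eq_translate D' 𝔣 𝔣' hHD hI f hT hg hf
    (D.thetaClasses_subset_hodge_F hHD 𝔣 hI ιinf hΔ hη Θ hω)
    (D'.thetaClasses_subset_hodge_F hHD 𝔣' hI ιinf' hΔ' hη' Θ' hω') h]

end TwoSituations

/-! ### One adelic group: the hypothesis on adelic functions, on the finite-adelic side, and as stability -/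

section OneSituation

variable {GU : Type*} [Group GU] {Kc Kc' : Type*} [Group Kc] [Group Kc']
variable {ΓU ΓU' : Subgroup GU} {κ : Kc →* GU} {κ' : Kc' →* GU}
variable {τ : Representation ℂ Kc (Fin 2 → ℂ)} {τ' : Representation ℂ Kc' (Fin 2 → ℂ)}
variable (ιinf : U21 →* GU) {η₁ : stabilizer U21 x₀ →* Kc} {η₁' : stabilizer U21 x₀ →* Kc'}
variable (hΔ : WeightForms.IsLevelCorrected ΓU κ τ ιinf (D.ballImage 𝔣))
  (hη : WeightForms.IsWeightMatched κ τ ιinf (stabilizer U21 x₀).subtype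
    (BallForms.isPullbackCocycle_cotangentCocycle.weightOf x₀) η₁)
  (hη' : WeightForms.IsWeightMatched κ' τ' ιinf (stabilizer U21 x₀).subtype
    (BallForms.isPullbackCocycle_cotangentCocycle.weightOf x₀) η₁')

/-- **One adelic group, hypothesis on adelic functions**: every `F ∈ Θ` has a partner `F' ∈ Θ'` with
`F'(ιinf x) = F(ιinf (γ x))`, `γ = frameIso 𝔣 g`; then `(f^* ⊗ ℂ) ω` is a theta class of `(D', Θ')`.
[cite: Borel1997, §5.13–5.14] [cite: Shimura1973, §7.2–7.3] -/
theorem pull_baseChange_mem_thetaClasses_of_mulVec_of_apply_eq (hHD : exists_isReal_hodgeModel)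
    (hI : hodgePQ_independent_of_hodgeModel)
    (hΔ' : WeightForms.IsLevelCorrected ΓU' κ' τ' ιinf (D'.ballImage 𝔣'))
    (Θ : Submodule ℂ (weightForms ΓU κ τ)) (Θ' : Submodule ℂ (weightForms ΓU' κ' τ')) (f : X' ⟶ X)
    (hT : 𝔣'.t = 𝔣.t) {g : GL (Fin 3) ℂ} (hg : g ∈ D.realPoints)
    (hf : ∀ v ∈ D'.cone, Motives.AlgPoints.map f (D'.unif v) = D.unif ((g : Matrix (Fin 3) (Fin 3) ℂ) *ᵥ v))
    {ω : ℂ ⊗[ℚ] bettiCohomology X 1}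
    (hω : ω ∈ WeightForms.thetaClasses ιinf (D.classMapDatum hHD 𝔣 hI ιinf hΔ hη) Θ)
    (hΘ : ∀ F ∈ Θ, ∃ F' ∈ Θ', ∀ x : U21,
      (F' : GU → Fin 2 → ℂ) (ιinf x) = (F : GU → Fin 2 → ℂ) (ιinf (D.frameIso 𝔣 ⟨g, hg⟩ * x))) :
    (BettiUniverse.pull f 1).baseChange ℂ ω ∈ WeightForms.thetaClasses ιinf (D'.classMapDatum hHD 𝔣' hI ιinf hΔ' hη') Θ' := by
  obtain ⟨ω', hω', h⟩ := D.exists_mem_thetaClasses_classLift_eq_translate_of_apply_eq D' hHD 𝔣 𝔣' hI ιinf hΔ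
    hη hη' hΔ' Θ Θ' (D.frameIso 𝔣 ⟨g, hg⟩) hω hΘ
  rwa [D.pull_baseChange_eq_of_classLift_eq_translate D' 𝔣 𝔣' hHD hI f hT hg hf
    (D.thetaClasses_subset_hodge_F hHD 𝔣 hI ιinf hΔ hη Θ hω)
    (D'.thetaClasses_subset_hodge_F hHD 𝔣' hI ιinf hΔ' hη' Θ' hω') h]

/-- **Hypothesis on the finite-adelic side.**  For `γ = frameIso 𝔣 g` RATIONAL (`ιinf γ · k ∈ ΓU` with `k`
commuting with `ιinf (U(2,1))` — `k` is its finite-adelic component): if for every `F ∈ Θ` the space `Θ'`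
contains a form `F'` with `F'(y) = F(y k⁻¹)`, then `(f^* ⊗ ℂ) ω` is a theta class of `(D', Θ')` for every theta
class `ω` of `(D, Θ)` (a rational left translate downstairs is a finite-adelic right translate upstairs,
`WeightForms.comp_leftTranslate_eq`). [cite: Borel1997, §5.13–5.14] [cite: Shimura1973, §7.2–7.3] -/
theorem pull_baseChange_mem_thetaClasses_of_mulVec_of_rightTranslate (hHD : exists_isReal_hodgeModel)
    (hI : hodgePQ_independent_of_hodgeModel)
    (hΔ' : WeightForms.IsLevelCorrected ΓU' κ' τ' ιinf (D'.ballImage 𝔣'))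
    (Θ : Submodule ℂ (weightForms ΓU κ τ)) (Θ' : Submodule ℂ (weightForms ΓU' κ' τ')) (f : X' ⟶ X)
    (hT : 𝔣'.t = 𝔣.t) {g : GL (Fin 3) ℂ} (hg : g ∈ D.realPoints)
    (hf : ∀ v ∈ D'.cone, Motives.AlgPoints.map f (D'.unif v) = D.unif ((g : Matrix (Fin 3) (Fin 3) ℂ) *ᵥ v))
    {k : GU} (hγk : ιinf (D.frameIso 𝔣 ⟨g, hg⟩) * k ∈ ΓU) (hk : ∀ x : U21, Commute k (ιinf x))
    {ω : ℂ ⊗[ℚ] bettiCohomology X 1}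
    (hω : ω ∈ WeightForms.thetaClasses ιinf (D.classMapDatum hHD 𝔣 hI ιinf hΔ hη) Θ)
    (hΘ : ∀ F ∈ Θ, ∃ F' ∈ Θ', ∀ y : GU, (F' : GU → Fin 2 → ℂ) y = (F : GU → Fin 2 → ℂ) (y * k⁻¹)) :
    (BettiUniverse.pull f 1).baseChange ℂ ω ∈ WeightForms.thetaClasses ιinf (D'.classMapDatum hHD 𝔣' hI ιinf hΔ' hη') Θ' := by
  obtain ⟨ω', hω', h⟩ := D.exists_mem_thetaClasses_classLift_eq_of_rightTranslate D' hHD 𝔣 𝔣' hI ιinf hΔ hη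
    hη' hΔ' Θ Θ' hγk hk hω hΘ
  rwa [D.pull_baseChange_eq_of_classLift_eq_translate D' 𝔣 𝔣' hHD hI f hT hg hf
    (D.thetaClasses_subset_hodge_F hHD 𝔣 hI ιinf hΔ hη Θ hω)
    (D'.thetaClasses_subset_hodge_F hHD 𝔣' hI ιinf hΔ' hη' Θ' hω') h]

/-- **Hecke-translate version (the inputs of record).**  With `F' := R(k⁻¹) F` the tree's level-moving right
translate `ThetaKernelDatum.rightTranslateHom κ κ' η k⁻¹ hh hτ F` (`Weil1964/ThetaWeightForms` §5b): if `f : X' ⟶ X`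
lies over the real point `g`, `γ = frameIso 𝔣 g` is rational with finite-adelic component `k`, and the space of
adelic forms is STABLE, `R(k⁻¹) Θ ⊆ Θ'` (for theta forms: `rightTranslateHom_thetaForm`), then the pull-back
`(f^* ⊗ ℂ) ω` of every theta class `ω` of `(D, Θ)` is a theta class of `(D', Θ')` — PerL v5 §3.1
«`γ^* u_f = u_{R(γ_f⁻¹) f}`» on cohomology classes. [cite: Borel1997, §5.13–5.14] [cite: Shimura1973, §7.2–7.3] -/
theorem pull_baseChange_mem_thetaClasses_of_mulVec_of_rightTranslateHom (hHD : exists_isReal_hodgeModel)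
    (hI : hodgePQ_independent_of_hodgeModel)
    (Θ : Submodule ℂ (weightForms ΓU κ τ)) (Θ' : Submodule ℂ (weightForms ΓU κ' τ')) {η : Kc' →* Kc}
    (hΔ' : WeightForms.IsLevelCorrected ΓU κ' τ' ιinf (D'.ballImage 𝔣')) (f : X' ⟶ X) (hT : 𝔣'.t = 𝔣.t)
    {g : GL (Fin 3) ℂ} (hg : g ∈ D.realPoints)
    (hf : ∀ v ∈ D'.cone, Motives.AlgPoints.map f (D'.unif v) = D.unif ((g : Matrix (Fin 3) (Fin 3) ℂ) *ᵥ v))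
    {k : GU} (hγk : ιinf (D.frameIso 𝔣 ⟨g, hg⟩) * k ∈ ΓU) (hk : ∀ x : U21, Commute k (ιinf x))
    (hh : ∀ k' : Kc', κ' k' * k⁻¹ = k⁻¹ * κ (η k')) (hτ : ∀ k' : Kc', τ' k' = τ (η k'))
    {ω : ℂ ⊗[ℚ] bettiCohomology X 1}
    (hω : ω ∈ WeightForms.thetaClasses ιinf (D.classMapDatum hHD 𝔣 hI ιinf hΔ hη) Θ)
    (hΘ : ∀ F ∈ Θ, NumberTheory.Weil1964.ThetaKernelDatum.rightTranslateHom κ κ' η k⁻¹ hh hτ F ∈ Θ') :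
    (BettiUniverse.pull f 1).baseChange ℂ ω ∈ WeightForms.thetaClasses ιinf (D'.classMapDatum hHD 𝔣' hI ιinf hΔ' hη') Θ' := by
  obtain ⟨ω', hω', h⟩ := D.exists_mem_thetaClasses_classLift_eq_of_rightTranslateHom D' hHD 𝔣 𝔣' hI ιinf hΔ hη
    hη' Θ Θ' hΔ' hγk hk hh hτ hω hΘ
  rwa [D.pull_baseChange_eq_of_classLift_eq_translate D' 𝔣 𝔣' hHD hI f hT hg hf
    (D.thetaClasses_subset_hodge_F hHD 𝔣 hI ιinf hΔ hη Θ hω)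
    (D'.thetaClasses_subset_hodge_F hHD 𝔣' hI ιinf hΔ' hη' Θ' hω') h]

/-- **As an inclusion of images** (stability of the theta-class sets under pull-back along a morphism over a
rational real point): `(f^* ⊗ ℂ) '' thetaClasses(D, Θ) ⊆ thetaClasses(D', Θ')`.
[cite: Borel1997, §5.13–5.14] [cite: Shimura1973, §7.2–7.3] -/
theorem thetaClasses_image_pull_baseChange_subset_of_mulVec_of_rightTranslate (hHD : exists_isReal_hodgeModel)
    (hI : hodgePQ_independent_of_hodgeModel)
    (hΔ' : WeightForms.IsLevelCorrected ΓU' κ' τ' ιinf (D'.ballImage 𝔣'))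
    (Θ : Submodule ℂ (weightForms ΓU κ τ)) (Θ' : Submodule ℂ (weightForms ΓU' κ' τ')) (f : X' ⟶ X)
    (hT : 𝔣'.t = 𝔣.t) {g : GL (Fin 3) ℂ} (hg : g ∈ D.realPoints)
    (hf : ∀ v ∈ D'.cone, Motives.AlgPoints.map f (D'.unif v) = D.unif ((g : Matrix (Fin 3) (Fin 3) ℂ) *ᵥ v))
    {k : GU} (hγk : ιinf (D.frameIso 𝔣 ⟨g, hg⟩) * k ∈ ΓU) (hk : ∀ x : U21, Commute k (ιinf x))
    (hΘ : ∀ F ∈ Θ, ∃ F' ∈ Θ', ∀ y : GU, (F' : GU → Fin 2 → ℂ) y = (F : GU → Fin 2 → ℂ) (y * k⁻¹)) :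
    (BettiUniverse.pull f 1).baseChange ℂ '' WeightForms.thetaClasses ιinf (D.classMapDatum hHD 𝔣 hI ιinf hΔ hη) Θ ⊆
      WeightForms.thetaClasses ιinf (D'.classMapDatum hHD 𝔣' hI ιinf hΔ' hη') Θ' := by
  rintro _ ⟨ω, hω, rfl⟩
  exact D.pull_baseChange_mem_thetaClasses_of_mulVec_of_rightTranslate D' 𝔣 𝔣' ιinf hΔ hη hη' hHD hI hΔ' Θ Θ'
    f hT hg hf hγk hk hω hΘ

end OneSituation

end UnitaryBallUniformisationDatum

end Literature.AlgebraicGeometry.ShimuraVarieties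

end
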